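import Summits.QuantumFields.YangMills.Theorems.FemtoTransferGap
import Literature.MathematicalPhysics.QuantumFieldTheory.Balaban1983to89.B15Prop1ChartCalculusSU2
import HarnessLib

/-!
# The TWO-ANCHOR WINDOW MAP of the slice chart on `X_fix` — definitions
# (layer (B2) of the DIRECT Laplace road to ⟨stmt-QuantumFields-24204⟩ `VirialFluxGap.SharpTwistedLaplace`)

Problem-side definitions (free-hands work of width seat ym-line-sfw-p2-w3 g57, cell ym-idea-1; `--supports 24204`).  The residual constant
`SU(2)` of the tree-gauged ring space acts by conjugation; its critical orbits `SU(2)·Q_s` are decided on TWO ANCHOR components of `Q_s`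
(✓`VirialFluxGapAnchorSliceAlgebra`): the seam site `0` (value `C₀`, `su2Quat C₀ = ιω_C`) and the wrapping link `e₀` of slice `0` (value `N₀`,
`su2Quat N₀ = ±ιω_N`, `ω_N ⊥ ω_C`, `ιω_× = ιω_C ιω_N`).  This file fixes the letters of the 6-dimensional ANCHOR CORE of the slice chart:

* `seamSlice ω_C C₀ t = expPoint(t ω_C)·C₀` — the 1-parameter slice through `C₀` (direction `ω_C`, the axis of `C₀`);
* `linkSlice ω_N ω_× N₀ b₁ b₂ = expPoint(b₁ω_N + b₂ω_×)·N₀` — the 2-parameter slice through `N₀` (directions `⊥ ω_C`);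
* `anchorMap … (z, a) = (k·seamSlice(a₀)·k⁻¹, k·linkSlice(a₁,a₂)·k⁻¹)`, `k = expPoint z` — the WINDOW MAP `Θ'` of the orbit-tube theorem
  (✓`Literature.MeasureTheory.Group.OrbitTubeMeasure.restrict_tube_eq_map_withDensity_ofReal`) on the anchor pair, `ℝ³ × ℝ³ → SU2 × SU2`;
* `anchorCoord … w = (logVec ∘ su2Quat)² (anchorMap w)` — the same map read in the EXPONENTIAL COORDINATES of `SU2 × SU2` at the identity
  (✓`T4ExpWindowSmallField.logVec`, ✓`T4HaarSU2ExpChart.expPoint`), a map `ℝ³ × ℝ³ → ℝ³ × ℝ³` to which Mathlib's change of variables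
  (`MeasureTheory.map_withDensity_abs_det_fderiv_eq_addHaar`) applies;
* `anchorDensity … w = |det D(anchorCoord)(w)| · w_exp((anchorCoord w).1) · w_exp((anchorCoord w).2)` — the density of `Θ'^*(Haar ⊗ Haar)`
  against Lebesgue measure `dz da` (`w_exp = (2π²)⁻¹ sinc²‖·‖`, ✓`T4HaarSU2ExpChart.expWeight`).

HONEST FRAMING: definitions only (no theorem, no `sorry`); nothing about ⟨24204⟩ is proved here; the Yang–Mills mass gap is NOT proved; no summit is
proved by a line.

## References
* G. E. Bredon, *Introduction to Compact Transformation Groups* (1972), Ch. II §§4–5 (slices and tubes). [Bredon1972]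
* K. W. Breitung, *Asymptotic Approximations for Probability Integrals*, LNM 1592 (1994), §2.3 Definitions 4–5 (local coordinates). [Breitung1994]
-/

set_option autoImplicit false

noncomputable section

open Literature.MathematicalPhysics.QuantumLattice
open Literature.MathematicalPhysics.QuantumFieldTheory.Balaban1983to89.T4HaarSU2ExpChart
open Literature.MathematicalPhysics.QuantumFieldTheory.Balaban1983to89.T4ExpWindowSmallField
open Summit.QuantumFields.YangMills.Theorems.FemtoTransferGap

namespace Summit.QuantumFields.YangMills.Theorems.VirialFluxGap.AnchorSlice

/-- The 1-parameter slice through the seam anchor `C₀` along its own axis `ω_C`: `t ↦ expPoint(t ω_C)·C₀`. [cite: Bredon1972, Ch. II §4] -/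
def seamSlice (ωC : EuclideanSpace ℝ (Fin 3)) (C₀ : SU2) (t : ℝ) : SU2 :=
  expPoint (t • ωC) * C₀

/-- The 2-parameter slice through the link anchor `N₀` in the directions `ω_N, ω_×` orthogonal to `ω_C`:
`(b₁, b₂) ↦ expPoint(b₁ω_N + b₂ω_×)·N₀`. [cite: Bredon1972, Ch. II §4] -/
def linkSlice (ωN ωX : EuclideanSpace ℝ (Fin 3)) (N₀ : SU2) (b₁ b₂ : ℝ) : SU2 :=
  expPoint (b₁ • ωN + b₂ • ωX) * N₀

/-- **THE TWO-ANCHOR WINDOW MAP** `Θ'(z, a) = (k·seamSlice(a₀)·k⁻¹, k·linkSlice(a₁, a₂)·k⁻¹)`, `k = expPoint z`: group window `z ∈ ℝ³`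
(exponential coordinates of the residual `SU(2)`), slice window `a = (a₀, a₁, a₂) ∈ ℝ³`. [cite: Bredon1972, Ch. II §§4–5]
[cite: Breitung1994, §2.3 Definitions 4–5] -/
def anchorMap (ωC ωN ωX : EuclideanSpace ℝ (Fin 3)) (C₀ N₀ : SU2)
    (w : EuclideanSpace ℝ (Fin 3) × EuclideanSpace ℝ (Fin 3)) : SU2 × SU2 :=
  (expPoint w.1 * seamSlice ωC C₀ (w.2 0) * (expPoint w.1)⁻¹,
    expPoint w.1 * linkSlice ωN ωX N₀ (w.2 1) (w.2 2) * (expPoint w.1)⁻¹)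

/-- **THE WINDOW MAP IN EXPONENTIAL COORDINATES** of `SU2 × SU2` at the identity: `(logVec ∘ su2Quat)²∘Θ'`, a map `ℝ³ × ℝ³ → ℝ³ × ℝ³`
(near the base point both anchors have vanishing real part, where `logVec` is smooth). [cite: Breitung1994, §2.3 Definitions 4–5] -/
def anchorCoord (ωC ωN ωX : EuclideanSpace ℝ (Fin 3)) (C₀ N₀ : SU2)
    (w : EuclideanSpace ℝ (Fin 3) × EuclideanSpace ℝ (Fin 3)) : EuclideanSpace ℝ (Fin 3) × EuclideanSpace ℝ (Fin 3) :=
  (logVec (su2Quat (anchorMap ωC ωN ωX C₀ N₀ w).1), logVec (su2Quat (anchorMap ωC ωN ωX C₀ N₀ w).2))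

/-- **THE DENSITY** of `Θ'^*(Haar ⊗ Haar)` against Lebesgue measure `dz da`: `|det D(anchorCoord)(w)| · w_exp · w_exp` evaluated at the
exponential coordinates (`w_exp = (2π²)⁻¹ sinc² ‖·‖`, the Haar density of the exponential chart). [cite: Breitung1994, §2.3 Definitions 4–5] -/
def anchorDensity (ωC ωN ωX : EuclideanSpace ℝ (Fin 3)) (C₀ N₀ : SU2)
    (w : EuclideanSpace ℝ (Fin 3) × EuclideanSpace ℝ (Fin 3)) : ℝ :=
  |(fderiv ℝ (anchorCoord ωC ωN ωX C₀ N₀) w).det| *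
    (expWeight (anchorCoord ωC ωN ωX C₀ N₀ w).1 * expWeight (anchorCoord ωC ωN ωX C₀ N₀ w).2)

end Summit.QuantumFields.YangMills.Theorems.VirialFluxGap.AnchorSlice

end
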